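import Literature.Computability.Complexity.CodeFPListKit
import Literature.Computability.Complexity.CodeFPArith
import Summits.PneNP.PneNP.Theorems.SfmBlMachineCaps

/-!
# Sign-degree-2 engine, MACHINE LAYER G1: block splitting of a GENERIC raw-leg list (cell pnp-ideate,
# ROUND-18 item K1'' `SignDeg2Signing.SignDeg2SigningFP`, stage S3)

FRONTIER (range avoidance for sign-degree-≤2 local maps at linear stretch; restricted-model algorithmic
rung); nothing here bears on P vs NP.

The landed machine of the line «sfm-bl» (`SfmBlMachine*`, pure CAND) builds its pieced legs from the triple
list of a 3-local instance (`SfmBlMachine.pieceLegs L trips`, legs `3j + t`).  Everything DOWNSTREAM of the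
pieced-leg list (`pieces`, `walksC`, `cands`, `extract`, `rlegs`, `aseqsC`, `traceSum`, `allRecs`, `hatSum`)
is generic in a list `plegs : List PLeg`.  This file supplies the generic FRONT: a RAW LEG is
`(out, tag, lv, rv) : ℕ⁴` (output, an injective tag, the left owner code, the right owner code); block splitting
puts raw leg `i` into block `rank / L` of its owner on each side (`rankLG`, `rankRG` = number of earlier raw legs
with the same owner), `plegG L raw i = (out, tag, lv, rankLG / L, rv, rankRG / L)`,
`pieceLegsG L raw` = all of them in order.  Proved: index lemmas, ranks increase along a fibre, hence
**every piece has at most `L` legs** (`length_nbrs_pieceLegsG_le`) and the walk / alternating-sequence counts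
the caps of the downstream enumerations need (`length_walksU_pieceLegsG_le`, `length_aseqsU_rlegs_pieceLegsG_le`);
and the `CodeFP` typing `codeFP_pieceLegsG` (binary numerals).  Pattern: `SfmBlMachinePieces` /
`SfmBlMachineDegree` / `SfmBlMachineCaps` with `trips ↦ raw`.
-/

set_option linter.dupNamespace false -- `Summit.PneNP.PneNP.…`: summit = sub-problem name (D-0017 single-conjunct layout)

namespace Summit.PneNP.PneNP.Theorems.Sd2BlMachine

open Literature.Computability.Complexity CodeFP
open Summit.PneNP.PneNP.Theorems.SfmBlMachine

/-! ## The spec: raw legs, ranks, pieced legs -/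

/-- A raw leg `(out, tag, lv, rv)`. -/
abbrev RLeg := ℕ × ℕ × ℕ × ℕ

/-- The default raw leg. -/
def dRLeg : RLeg := (0, 0, 0, 0)

/-- Left owner code of raw leg `i` (`0` past the end). -/
def lvertG (raw : List RLeg) (i : ℕ) : ℕ := (raw.getD i dRLeg).2.2.1

/-- Right owner code of raw leg `i`. -/
def rvertG (raw : List RLeg) (i : ℕ) : ℕ := (raw.getD i dRLeg).2.2.2

/-- Rank of raw leg `i` in its LEFT fibre: the number of earlier raw legs with the same left owner. -/
def rankLG (raw : List RLeg) (i : ℕ) : ℕ :=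
  ((List.range (min i raw.length)).map (lvertG raw)).count (lvertG raw i)

/-- Rank of raw leg `i` in its RIGHT fibre. -/
def rankRG (raw : List RLeg) (i : ℕ) : ℕ :=
  ((List.range (min i raw.length)).map (rvertG raw)).count (rvertG raw i)

/-- The PIECED LEG `i` for block length `L`: `(out, tag, lv, rankL / L, rv, rankR / L)`. -/
def plegG (L : ℕ) (raw : List RLeg) (i : ℕ) : PLeg :=
  ((raw.getD i dRLeg).1, (raw.getD i dRLeg).2.1, lvertG raw i, rankLG raw i / L, rvertG raw i, rankRG raw i / L)

/-- All pieced legs, in index order. -/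
def pieceLegsG (L : ℕ) (raw : List RLeg) : List PLeg := (List.range raw.length).map (plegG L raw)

/-! ## Index lemmas -/

/-- One pieced leg per raw leg. -/
theorem length_pieceLegsG (L : ℕ) (raw : List RLeg) : (pieceLegsG L raw).length = raw.length := by
  simp [pieceLegsG]

/-- The `i`-th pieced leg is `plegG L raw i`. -/
theorem pieceLegsG_getElem (L : ℕ) (raw : List RLeg) (i : ℕ) (hi : i < (pieceLegsG L raw).length) :
    (pieceLegsG L raw)[i] = plegG L raw i := by
  simp [pieceLegsG]

/-- Membership in the pieced-leg list. -/
theorem mem_pieceLegsG_iff (L : ℕ) (raw : List RLeg) (x : PLeg) :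
    x ∈ pieceLegsG L raw ↔ ∃ i, i < raw.length ∧ plegG L raw i = x := by
  simp [pieceLegsG]

/-- The output field of pieced leg `i` is the output of raw leg `i`. -/
theorem plegG_out (L : ℕ) (raw : List RLeg) (i : ℕ) (hi : i < raw.length) : (plegG L raw i).1 = (raw[i]).1 := by
  simp [plegG, List.getElem?_eq_getElem hi]

/-- The tag field of pieced leg `i` is the tag of raw leg `i`. -/
theorem plegG_tag (L : ℕ) (raw : List RLeg) (i : ℕ) (hi : i < raw.length) : (plegG L raw i).2.1 = (raw[i]).2.1 := by
  simp [plegG, List.getElem?_eq_getElem hi]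

/-- The left label of pieced leg `i` is `(0, lv_i, rankL_i / L)`. -/
theorem labL_plegG (L : ℕ) (raw : List RLeg) (i : ℕ) :
    labL (plegG L raw i) = (0, lvertG raw i, rankLG raw i / L) := rfl

/-- The right label of pieced leg `i` is `(1, rv_i, rankR_i / L)`. -/
theorem labR_plegG (L : ℕ) (raw : List RLeg) (i : ℕ) :
    labR (plegG L raw i) = (1, rvertG raw i, rankRG raw i / L) := rfl

/-- For a genuine raw leg the left owner code is the third field. -/
theorem lvertG_eq (raw : List RLeg) (i : ℕ) (hi : i < raw.length) : lvertG raw i = (raw[i]).2.2.1 := by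
  simp [lvertG, List.getElem?_eq_getElem hi]

/-- For a genuine raw leg the right owner code is the fourth field. -/
theorem rvertG_eq (raw : List RLeg) (i : ℕ) (hi : i < raw.length) : rvertG raw i = (raw[i]).2.2.2 := by
  simp [rvertG, List.getElem?_eq_getElem hi]

/-- For a genuine leg `i` the left rank is the number of earlier legs with the same left owner. -/
theorem rankLG_eq_countP (raw : List RLeg) {i : ℕ} (hi : i < raw.length) :
    rankLG raw i = (List.range i).countP (fun i' => lvertG raw i' = lvertG raw i) := by
  unfold rankLG
  rw [min_eq_left hi.le, List.count, List.countP_map]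
  congr 1

/-- For a genuine leg `i` the right rank is the number of earlier legs with the same right owner. -/
theorem rankRG_eq_countP (raw : List RLeg) {i : ℕ} (hi : i < raw.length) :
    rankRG raw i = (List.range i).countP (fun i' => rvertG raw i' = rvertG raw i) := by
  unfold rankRG
  rw [min_eq_left hi.le, List.count, List.countP_map]
  congr 1

/-- `Finset` form of the left rank. -/
theorem rankLG_eq_card (raw : List RLeg) {i : ℕ} (hi : i < raw.length) :
    rankLG raw i = ((Finset.range i).filter (fun i' => lvertG raw i' = lvertG raw i)).card := by
  rw [rankLG_eq_countP raw hi, List.countP_eq_length_filter]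
  rfl

/-- `Finset` form of the right rank. -/
theorem rankRG_eq_card (raw : List RLeg) {i : ℕ} (hi : i < raw.length) :
    rankRG raw i = ((Finset.range i).filter (fun i' => rvertG raw i' = rvertG raw i)).card := by
  rw [rankRG_eq_countP raw hi, List.countP_eq_length_filter]
  rfl

/-! ## Ranks increase along a fibre; legs per piece -/

/-- Along a left fibre the rank is strictly increasing in the leg index. -/
theorem rankLG_lt_rankLG (raw : List RLeg) {i i' : ℕ} (hii' : i < i') (hi' : i' < raw.length)
    (hv : lvertG raw i = lvertG raw i') : rankLG raw i < rankLG raw i' := by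
  rw [rankLG_eq_countP raw (hii'.trans hi'), rankLG_eq_countP raw hi', hv]
  have hsub : List.Sublist (List.range (i + 1)) (List.range i') := List.range_sublist.2 hii'
  have h1 := hsub.countP_le (p := fun k => decide (lvertG raw k = lvertG raw i'))
  rw [List.range_succ, List.countP_append] at h1
  have h2 : List.countP (fun k => decide (lvertG raw k = lvertG raw i')) [i] = 1 := by
    simp [hv]
  omega

/-- Along a right fibre the rank is strictly increasing in the leg index. -/
theorem rankRG_lt_rankRG (raw : List RLeg) {i i' : ℕ} (hii' : i < i') (hi' : i' < raw.length)
    (hv : rvertG raw i = rvertG raw i') : rankRG raw i < rankRG raw i' := by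
  rw [rankRG_eq_countP raw (hii'.trans hi'), rankRG_eq_countP raw hi', hv]
  have hsub : List.Sublist (List.range (i + 1)) (List.range i') := List.range_sublist.2 hii'
  have h1 := hsub.countP_le (p := fun k => decide (rvertG raw k = rvertG raw i'))
  rw [List.range_succ, List.countP_append] at h1
  have h2 : List.countP (fun k => decide (rvertG raw k = rvertG raw i')) [i] = 1 := by
    simp [hv]
  omega

/-- The legs at a LEFT piece `(0, c, blk)` are indexed by the `i` with left owner `c` and left block `blk`. -/
theorem filter_labL_pieceLegsG (L : ℕ) (raw : List RLeg) (c blk : ℕ) :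
    ((pieceLegsG L raw).filter fun x => labL x = (0, c, blk))
      = ((List.range raw.length).filter fun i => lvertG raw i = c ∧ rankLG raw i / L = blk).map (plegG L raw) := by
  unfold pieceLegsG
  rw [List.filter_map]
  congr 1
  apply List.filter_congr
  intro i _
  simp [labL, plegG, Function.comp]

/-- Same on the right. -/
theorem filter_labR_pieceLegsG (L : ℕ) (raw : List RLeg) (v blk : ℕ) :
    ((pieceLegsG L raw).filter fun x => labR x = (1, v, blk))
      = ((List.range raw.length).filter fun i => rvertG raw i = v ∧ rankRG raw i / L = blk).map (plegG L raw) := by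
  unfold pieceLegsG
  rw [List.filter_map]
  congr 1
  apply List.filter_congr
  intro i _
  simp [labR, plegG, Function.comp]

/-- No pieced leg has a left label with side tag `≠ 0`. -/
theorem filter_labL_eq_nil_G (L : ℕ) (raw : List RLeg) (P : Lab) (hP : P.1 ≠ 0) :
    ((pieceLegsG L raw).filter fun x => labL x = P) = [] := by
  rw [List.filter_eq_nil_iff]
  intro x _
  simp only [decide_eq_true_eq]
  intro h
  exact hP (by rw [← h]; rfl)

/-- No pieced leg has a right label with side tag `≠ 1`. -/
theorem filter_labR_eq_nil_G (L : ℕ) (raw : List RLeg) (P : Lab) (hP : P.1 ≠ 1) :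
    ((pieceLegsG L raw).filter fun x => labR x = P) = [] := by
  rw [List.filter_eq_nil_iff]
  intro x _
  simp only [decide_eq_true_eq]
  intro h
  exact hP (by rw [← h]; rfl)

/-- At most `L` legs sit in one LEFT block. -/
theorem length_filter_lblockG_le {L : ℕ} (hL : 0 < L) (raw : List RLeg) (c blk : ℕ) :
    ((List.range raw.length).filter fun i => lvertG raw i = c ∧ rankLG raw i / L = blk).length ≤ L := by
  refine length_le_of_strictMono_window (List.pairwise_lt_range.sublist List.filter_sublist) (rankLG raw)
    (fun a ha b hb hab => ?_) (lo := blk * L) (fun a ha => ?_)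
  · simp only [List.mem_filter, List.mem_range, decide_eq_true_eq] at ha hb
    exact rankLG_lt_rankLG raw hab hb.1 (ha.2.1.trans hb.2.1.symm)
  · simp only [List.mem_filter, List.mem_range, decide_eq_true_eq] at ha
    have h := ha.2.2
    constructor
    · rw [← h]; exact Nat.div_mul_le_self _ _
    · rw [← h]; rw [mul_comm]; exact Nat.lt_mul_div_succ _ hL

/-- At most `L` legs sit in one RIGHT block. -/
theorem length_filter_rblockG_le {L : ℕ} (hL : 0 < L) (raw : List RLeg) (v blk : ℕ) :
    ((List.range raw.length).filter fun i => rvertG raw i = v ∧ rankRG raw i / L = blk).length ≤ L := by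
  refine length_le_of_strictMono_window (List.pairwise_lt_range.sublist List.filter_sublist) (rankRG raw)
    (fun a ha b hb hab => ?_) (lo := blk * L) (fun a ha => ?_)
  · simp only [List.mem_filter, List.mem_range, decide_eq_true_eq] at ha hb
    exact rankRG_lt_rankRG raw hab hb.1 (ha.2.1.trans hb.2.1.symm)
  · simp only [List.mem_filter, List.mem_range, decide_eq_true_eq] at ha
    have h := ha.2.2
    constructor
    · rw [← h]; exact Nat.div_mul_le_self _ _
    · rw [← h]; rw [mul_comm]; exact Nat.lt_mul_div_succ _ hL

/-- **EVERY PIECE HAS AT MOST `L` LEGS** in the piece multigraph of the block-split raw legs. -/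
theorem length_nbrs_pieceLegsG_le {L : ℕ} (hL : 0 < L) (raw : List RLeg) (P : Lab) :
    (nbrs (pieceLegsG L raw) P).length ≤ L := by
  obtain ⟨s, c, blk⟩ := P
  unfold nbrs
  rw [List.length_append, List.length_map, List.length_map]
  by_cases h0 : s = 0
  · subst h0
    rw [filter_labL_pieceLegsG, filter_labR_eq_nil_G L raw (0, c, blk) (by norm_num), List.length_map,
      List.length_nil, add_zero]
    exact length_filter_lblockG_le hL raw c blk
  · by_cases h1 : s = 1
    · subst h1
      rw [filter_labR_pieceLegsG, filter_labL_eq_nil_G L raw (1, c, blk) (by norm_num), List.length_map,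
        List.length_nil, zero_add]
      exact length_filter_rblockG_le hL raw c blk
    · rw [filter_labL_eq_nil_G L raw (s, c, blk) h0, filter_labR_eq_nil_G L raw (s, c, blk) h1]
      simp

/-- The walk counts of the block-split raw legs: `#walks_ℓ ≤ #pieces · L^ℓ`. -/
theorem length_walksU_pieceLegsG_le {L : ℕ} (hL : 0 < L) (raw : List RLeg) (ℓ : ℕ) :
    (walksU (pieceLegsG L raw) ℓ).length ≤ (pieces (pieceLegsG L raw)).length * L ^ ℓ :=
  length_walksU_le _ (length_nbrs_pieceLegsG_le hL raw) ℓ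

/-- Every left fibre of the remainder legs has at most `L` legs. -/
theorem length_filter_rlegs_labL_le_G {L : ℕ} (hL : 0 < L) (raw : List RLeg) (labels : List ℕ) (P : Lab) :
    ((rlegs (pieceLegsG L raw) labels).filter fun y => labL y = P).length ≤ L := by
  refine (((rlegs_sublist _ labels).filter _).length_le).trans ?_
  have := length_nbrs_pieceLegsG_le hL raw P
  unfold nbrs at this
  rw [List.length_append, List.length_map, List.length_map] at this
  omega

/-- Every right fibre of the remainder legs has at most `L` legs. -/
theorem length_filter_rlegs_labR_le_G {L : ℕ} (hL : 0 < L) (raw : List RLeg) (labels : List ℕ) (P : Lab) :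
    ((rlegs (pieceLegsG L raw) labels).filter fun y => labR y = P).length ≤ L := by
  refine (((rlegs_sublist _ labels).filter _).length_le).trans ?_
  have := length_nbrs_pieceLegsG_le hL raw P
  unfold nbrs at this
  rw [List.length_append, List.length_map, List.length_map] at this
  omega

/-- The count of alternating leg-sequences over the remainder legs: `≤ |raw| · L^t`. -/
theorem length_aseqsU_rlegs_pieceLegsG_le {L : ℕ} (hL : 0 < L) (raw : List RLeg) (labels : List ℕ) (t : ℕ) :
    (aseqsU (rlegs (pieceLegsG L raw) labels) t).length ≤ raw.length * L ^ t := by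
  refine (length_aseqsU_le _ (length_filter_rlegs_labL_le_G hL raw labels)
    (length_filter_rlegs_labR_le_G hL raw labels) t).trans ?_
  refine Nat.mul_le_mul_right _ ((length_rlegs_le _ labels).trans ?_)
  rw [length_pieceLegsG]

/-! ## Typing in the `CodeFP` algebra (binary numerals) -/

section PolyTime

open Polynomial

/-- Code of a raw leg (four binary numerals). -/
abbrev rlegE : RLeg → List Bool := pairE natE (pairE natE (pairE natE natE))

/-- Reading raw leg `i` (default past the end). -/
theorem codeFP_getRLeg : CodeFP (pairE (rawE rlegE) natE) rlegE (fun p => p.1.getD p.2 dRLeg) :=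
  ((rawGetOr rlegE).comp ((fst _ _).pair ((snd _ _).pair
    (const (pairE (rawE rlegE) natE) (eβ := rlegE) dRLeg)))).congr fun _ => rfl

/-- `lvertG` is polynomial time. -/
theorem codeFP_lvertG : CodeFP (pairE (rawE rlegE) natE) natE (fun p => lvertG p.1 p.2) :=
  codeFP_getRLeg.snd'.snd'.fst'.congr fun _ => rfl

/-- `rvertG` is polynomial time. -/
theorem codeFP_rvertG : CodeFP (pairE (rawE rlegE) natE) natE (fun p => rvertG p.1 p.2) :=
  codeFP_getRLeg.snd'.snd'.snd'.congr fun _ => rfl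

/-- The index range `[0, |raw|)`. -/
theorem codeFP_legRangeG : CodeFP (rawE rlegE) (rawE natE) (fun l => List.range l.length) :=
  (urange.comp (ulength rlegE)).congr fun _ => rfl

/-- The capped range `[0, min i |raw|)` of the earlier legs. -/
theorem codeFP_earlierG : CodeFP (pairE (rawE rlegE) natE) (rawE natE)
    (fun p => List.range (min p.2 p.1.length)) :=
  ((brange natE).comp ((codeFP_legRangeG.comp (fst _ _)).pair (snd _ _))).congr fun p => by
    simp [List.length_range]

/-- `rankLG` is polynomial time. -/
theorem codeFP_rankLG : CodeFP (pairE (rawE rlegE) natE) natE (fun p => rankLG p.1 p.2) := by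
  have hl : CodeFP (pairE (rawE rlegE) natE) (rawE natE)
      (fun p => (List.range (min p.2 p.1.length)).map (fun i' => lvertG p.1 i')) :=
    ((map codeFP_lvertG).comp ((fst _ _).pair codeFP_earlierG)).congr fun _ => rfl
  exact (rawCountNat.comp (codeFP_lvertG.pair hl)).congr fun _ => rfl

/-- `rankRG` is polynomial time. -/
theorem codeFP_rankRG : CodeFP (pairE (rawE rlegE) natE) natE (fun p => rankRG p.1 p.2) := by
  have hl : CodeFP (pairE (rawE rlegE) natE) (rawE natE)
      (fun p => (List.range (min p.2 p.1.length)).map (fun i' => rvertG p.1 i')) :=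
    ((map codeFP_rvertG).comp ((fst _ _).pair codeFP_earlierG)).congr fun _ => rfl
  exact (rawCountNat.comp (codeFP_rvertG.pair hl)).congr fun _ => rfl

/-- The pieced leg is polynomial time (block length `L` a constant of the algorithm). -/
theorem codeFP_plegG (L : ℕ) : CodeFP (pairE (rawE rlegE) natE) plegE (fun p => plegG L p.1 p.2) :=
  (codeFP_getRLeg.fst'.pair (codeFP_getRLeg.snd'.fst'.pair (codeFP_lvertG.pair
    ((natDiv.comp (codeFP_rankLG.pair (const _ L))).pair (codeFP_rvertG.pair
      (natDiv.comp (codeFP_rankRG.pair (const _ L)))))))).congr fun _ => rfl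

/-- **G1: the list of pieced legs is computed on codes in polynomial time.** -/
theorem codeFP_pieceLegsG (L : ℕ) : CodeFP (rawE rlegE) (rawE plegE) (pieceLegsG L) :=
  ((map (codeFP_plegG L)).comp ((CodeFP.id (rawE rlegE)).pair codeFP_legRangeG)).congr fun _ => rfl

end PolyTime

end Summit.PneNP.PneNP.Theorems.Sd2BlMachine
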